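import Summits.BirchSwinnertonDyer.BirchSwinnertonDyer.Theorems.ByReductionTypeAtTwoOrdEisensteinHalfShaCurrency
import Summits.BirchSwinnertonDyer.BirchSwinnertonDyer.Theorems.ByReductionTypeAtTwoOrdEisensteinHalfLowerBounds
import HarnessLib

/-!
# Route `AlignedTransportAtTwo`, crux C2 `MainConjectureOfRankZeroBSDAtTwo` (stmt-BirchSwinnertonDyer-22298, the SEED):
# the λ-FORM of the seed residue — modulo print, C2 says «Kato's λ-inequality at `2` is an equality on the seed cell»

HONEST FRAMING (cell `bsd-f1-sign2`, HOME `run/shared/lean/pub/bsd-f1-sign2/`, prover seat `bsd-line-att-p5`, WIDTH-5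
attach to line `birth` of the crux; BSD is NOT proved by any of this). THEOREMS ONLY — no definition, no named fact, nothing
asserted, closes nothing. Every deep input is DISPLAYED as a hypothesis which is a PUBLISHED named fact of the tree, exactly as
in the lead's file `AlignedTransportAtTwoMainConjectureOfRankZeroBSDAtTwoSeed.lean` (p583329): `h17` Kato 2004 Thm. 17.4
(1)(2) AT `2` (`kato_divisibility_allPrimes W 2`), `hGr`/`hEC` Greenberg 1999 Thm. 4.1 AT `2`
(`thm41_charValue_rankZero_anyPrime`, resp. its O1 form `X5.O1.TwoAdicEulerCharRankZero W 0`), `hper` the period unit at `2`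
(`realPeriodRat_eq_unit_mul_plusPeriod_two`), `hmod` modularity, `hGZK` Gross–Zagier–Kolyvagin.

THE LEAD'S RESIDUE (p583329): modulo PRINT the crux C2 is EQUIVALENT to `μ₂(X(W/ℚ_∞)) = 0` on the seed cell (Greenberg's
Conj. 1.11 at `2`, OPEN), and the crux's analytic hypothesis `μ(L₂) = 0` is idle for that form.

WHAT THIS FILE ADDS (kernel-checked; engine = the `bsd-2adic` cell's `EisensteinShaCurrency.sha_readings_of_kato` and
`EisensteinLowerBounds.*`; general rank-`0` good-ordinary-at-`2` curves — the seed cell itself is the sequel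
`AlignedTransportAtTwoMainConjectureOfRankZeroBSDAtTwoLambdaSeed.lean`):

1. §1, datum level. `charIdeal_eq_span_iff_lam_le_and_mu_le_and_missingUpperBoundAt`: the `2`-adic main conjecture at a
   cyclotomic datum (`char_Λ X = (L₀)`, Néron-integral `L₀`) holds IFF [`λ(L₀) ≤ λ(X)` ∧ `μ(L₀) ≤ μ(X)`] ∧
   `ord₂ #Ш ≤ ord₂ #Ш_an` — the EULER-SYSTEM-SIDE MIRROR of the tree's `charIdeal_eq_span_iff_mu_le_and_missingLowerBoundAt`
   (`μ(X) ≤ μ(L₀)` ∧ `ord₂ #Ш_an ≤ ord₂ #Ш`). With `μ(L₀) = 0` the `μ`-clause is free, and with both descent inequalities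
   (e.g. `BSD(E,2)`) `μ(X) = 0 ⟺ λ(L₀) ≤ λ(X) ⟺ λ(X) = λ(L₀)` (`mu_eq_zero_iff_lam_le`, `mu_eq_zero_iff_lambda_eq_lam`;
   Kato's clause (2) gives `λ(X) ≤ λ(L₀)` for free). This is the λ-FORM of the lead's residue: «`μ₂(X) = 0`» on a
   BSD₂-certified rank-`0` seed says exactly «Kato's λ-inequality at `2` is an equality» (Matsuno 2008 p. 420 (7):
   the main conjecture follows from `λ = λ_an` and `μ = μ_an = 0`; here the converse bookkeeping is made exact).
2. §2, curve level. `mazurMainConjecture_two_of_eisensteinHalf_of_missingUpperBoundAt`: on a rank-`0` good-ordinary curve the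
   EISENSTEIN half `X5.O1.MainConjectureEisensteinDivisibilityAtTwo W` + the UPPER bound on `Ш` give `MazurMainConjecture W 2`
   (mirror of the tree's `mazurMainConjecture_two_of_katoHalf_of_missingLowerBoundAt`); `missingUpperBoundAt_two_of_mazurMainConjecture`
   and `mazurMainConjecture_two_iff_missingUpperBoundAt_of_eisensteinHalf`: granted the Eisenstein half the main conjecture IS
   `MissingUpperBoundAt W 2`.

What this is NOT: not a proof of C2 (its residue, `μ_alg = 0` ⟺ `λ_alg = λ_an` on the seed cell, is OPEN: Kato's integral
clause 17.4 (3) prints `p ≠ 2`); not a certificate for any particular curve; BSD is not proved by any of this.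

References: K. Kato, Astérisque 295 (2004), Thm. 17.4; R. Greenberg, LNM 1716 (1999), Thm. 1.9, Thm. 4.1, Conj. 1.11;
R. Greenberg, V. Vatsal, Invent. Math. 142 (2000), pp. 2–4; K. Matsuno, Int. J. Number Theory 4 (2008), p. 420 (7);
R. L. Miller, LMS J. Comput. Math. 14 (2011), Def. 1.1; C. Skinner, E. Urban, Invent. Math. 195 (2014), Conj. 3.6.8.
-/

-- `Summit.BirchSwinnertonDyer.BirchSwinnertonDyer.…` is the tree's summit/sub-problem namespace (D-0017): the repeated
-- component is deliberate, so the duplicate-namespace linter is silenced for this file (as in the sibling Theorems files).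
set_option linter.dupNamespace false
set_option autoImplicit false

noncomputable section

open scoped Classical MatrixGroups ModularForm

open CongruenceSubgroup WeierstrassCurve Literature.NumberTheory.EllipticCurves
  Literature.NumberTheory.EllipticCurves.ModularForms
  Literature.NumberTheory.EllipticCurves.Rank1Residual
  Literature.NumberTheory.EllipticCurves.Rank1Residual.Typed
  Literature.NumberTheory.EllipticCurves.Greenberg1999
  Summit.BirchSwinnertonDyer.Rank1Residual
  Summit.BirchSwinnertonDyer.Rank1Residual.X1.MuLambda
  Summit.BirchSwinnertonDyer.Rank1Residual.X1.MuPart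
  Summit.BirchSwinnertonDyer.Rank1Residual.X1.ParitySqueeze
  Summit.BirchSwinnertonDyer.Rank1Residual.X5
  Summit.BirchSwinnertonDyer.BirchSwinnertonDyer.Theorems.Rank1ResidualX1Defs
  Summit.BirchSwinnertonDyer.BirchSwinnertonDyer.Theorems.EisensteinShaCurrency

namespace Summit.BirchSwinnertonDyer.BirchSwinnertonDyer.Theorems.AlignedTransportAtTwoSeedLambda

/-! ## §0 `Λ`-bookkeeping: a `2`-adic unit constant changes neither `λ` nor `μ` -/

/-- `λ(C c · G) = λ(G)` for a unit constant `c ∈ ℤ_pˣ` and `G ≠ 0` (`λ` is additive and a unit has `λ = 0`). [folklore] -/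
theorem lam_C_mul_of_isUnit {p : ℕ} [Fact p.Prime] {c : ℤ_[p]} (hc : IsUnit c) {G : IwasawaAlgebra p}
    (hG : G ≠ 0) : lam (PowerSeries.C c * G) = lam G := by
  have hCu : IsUnit (PowerSeries.C c : IwasawaAlgebra p) := hc.map _
  rw [lam_mul hCu.ne_zero hG, ((isUnit_iff_mu_eq_zero_and_lam_eq_zero _).mp hCu).2.2, zero_add]

/-! ## §1 Datum level: the main conjecture at a cyclotomic datum in `λ`-currency (rank `0`, good ordinary at `2`) -/

section Datum

variable (W : WeierstrassCurve ℚ) [W.IsElliptic] [W.IsGloballyMinimal]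

/-- **The `2`-adic main conjecture at a datum ⟺ the two LOWER bounds ∧ the UPPER bound on `Ш`.** `E = W` globally minimal,
good ordinary at `2`, `L(E,1) ≠ 0`; PUBLISHED inputs as hypotheses: Kato 17.4 (1)(2) AT `2` for the newform `f` (`h17`),
Greenberg 4.1 AT `2` (`hEC`), GZK (`hGZK`); a cyclotomic datum `(κ, γ, D)`, the ratio `ϖ` (`ϖ·Ω_E = Ω⁺_f`) and a Néron-integral
`L₀ ∈ Λ`, `ι L₀ = ϖ·L₂(f,α)`. Then `char_Λ X = (L₀)` IFF [`λ(L₀) ≤ λ(X)` ∧ `μ(L₀) ≤ μ(X)`] ∧ `ord₂ #Ш ≤ ord₂ #Ш_an`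
(`MissingUpperBoundAt W 2`). The Euler-system-side MIRROR of the tree's `charIdeal_eq_span_iff_mu_le_and_missingLowerBoundAt`:
there the Kato half's `μ`-inequality pairs with the LOWER bound on `Ш`, here the Eisenstein half's two inequalities pair with
the UPPER bound. Proof: Kato's readings (i) `ord₂ #Ш + μ(L₀) ≤ ord₂ #Ш_an + μ(X)` and (ii) `λ(L₀) ≤ λ(X) ⟺
ord₂ #Ш_an + μ(X) ≤ ord₂ #Ш + μ(L₀)` (`sha_readings_of_kato`) squeeze `μ(X) − μ(L₀) = ord₂ #Ш − ord₂ #Ш_an`, so the three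
inequalities force `μ(X) = μ(L₀)` and `ord₂ #Ш = ord₂ #Ш_an`, and the tree's (C) concludes.
[cite: Kato2004Asterisque, Thm. 17.4 (1)(2) (p. 273)] [cite: GreenbergLNM1716, Thm. 4.1 (p. 102)]
[cite: GreenbergVatsal2000, p. 4 (after Thm. (1.2))] -/
theorem charIdeal_eq_span_iff_lam_le_and_mu_le_and_missingUpperBoundAt {N : ℕ} [NeZero N]
    {f : CuspForm (Gamma0 N) 2} (h17 : kato_divisibility_allPrimes W 2 (f := f))
    (hEC : O1.TwoAdicEulerCharRankZero W 0) (hGZK : rank_eq_analyticRank_of_analyticRank_le_one)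
    (hord : IsOrdinaryAt W 2) (hL : W.entireLFunction 1 ≠ 0)
    {κ : ZpExtension ℚ 2} {γ : Field.absoluteGaloisGroup ℚ} (hκ : κ.IsCyclotomic)
    (hγ : κ.IsTopGenerator γ) (hγ' : IsCyclotomicVariable 2 γ) (hf : IsNewformOf W f)
    (D : W.SelmerDualData κ γ) {ϖ : ℚ} (hϖ : (ϖ : ℝ) * W.realPeriodRat = plusPeriod f)
    {L₀ : IwasawaAlgebra 2}
    (hL₀ : iwasawaToPowerSeries 2 L₀ =
      PowerSeries.C (ϖ : ℚ_[2]) * padicLFunction f (unitRoot W 2 : ℚ_[2])) :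
    D.charIdeal = Ideal.span {L₀} ↔
      (lam L₀ ≤ D.lambda ∧ mu L₀ ≤ D.mu) ∧ MissingUpperBoundAt W 2 := by
  haveI : Module.Finite (IwasawaAlgebra 2) D.X := D.module_finite_holds hγ
  have hϖ0 : ϖ ≠ 0 := X2.varpi_ne_zero_of_isNewformOf hf hϖ
  have hL₀0 : L₀ ≠ 0 := ne_zero_of_iwasawaToPowerSeries_eq W hord hf hϖ0 hL₀
  have hD : D.IsTorsion := (h17 κ γ hκ hγ hγ' hord hf D).1
  constructor
  · intro hMC
    have hμeq : mu L₀ = D.mu := mu_generator_eq_muInvariant D.X hD hL₀0 hMC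
    have hlameq : lam L₀ = D.lambda := lam_generator_eq_lambdaInvariant D.X hD hL₀0 hMC
    obtain ⟨q, hq, h1, -, -⟩ :=
      sha_readings_of_kato W h17 hEC hGZK hord hL hκ hγ hγ' hf D hϖ hϖ0 hMC hL₀
    have hμZ : (mu L₀ : ℤ) = D.mu := by exact_mod_cast hμeq
    exact ⟨⟨hlameq.le, hμeq.le⟩, q, hq, by linarith⟩
  · rintro ⟨⟨hlam, hmu⟩, q', hq', hup⟩
    obtain ⟨fX, hfX⟩ := (charIdeal_isPrincipal_holds 2 D.X).principal
    have hchar : D.charIdeal = Ideal.span {fX} := hfX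
    obtain ⟨q, hq, h1, h2, -⟩ :=
      sha_readings_of_kato W h17 hEC hGZK hord hL hκ hγ hγ' hf D hϖ hϖ0 hchar hL₀
    have hqq : q' = q := by exact_mod_cast hq'.symm.trans hq
    subst hqq
    have h2' := h2.mp hlam
    have hmuZ : (mu L₀ : ℤ) ≤ D.mu := by exact_mod_cast hmu
    have hμle : (D.mu : ℤ) ≤ mu L₀ := by linarith
    have hlow : MissingLowerBoundAt W 2 := ⟨q', hq, by linarith⟩
    exact (charIdeal_eq_span_iff_mu_le_and_missingLowerBoundAt W h17 hEC hGZK hord hL hκ hγ hγ' hf D hϖ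
      hL₀).mpr ⟨by exact_mod_cast hμle, hlow⟩

/-- **With `μ(L₀) = 0` the main conjecture at the datum IS `λ(L₀) ≤ λ(X)` ∧ the UPPER bound on `Ш`.** Same data,
`μ(L₀) = 0` (e.g. the crux's analytic hypothesis `red G ≠ 0`): `char_Λ X = (L₀) ⟺ λ(L₀) ≤ λ(X) ∧ MissingUpperBoundAt W 2`.
[cite: Kato2004Asterisque, Thm. 17.4 (1)(2) (p. 273)] [cite: GreenbergLNM1716, Thm. 4.1 (p. 102)] -/
theorem charIdeal_eq_span_iff_lam_le_and_missingUpperBoundAt_of_mu_eq_zero {N : ℕ} [NeZero N]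
    {f : CuspForm (Gamma0 N) 2} (h17 : kato_divisibility_allPrimes W 2 (f := f))
    (hEC : O1.TwoAdicEulerCharRankZero W 0) (hGZK : rank_eq_analyticRank_of_analyticRank_le_one)
    (hord : IsOrdinaryAt W 2) (hL : W.entireLFunction 1 ≠ 0)
    {κ : ZpExtension ℚ 2} {γ : Field.absoluteGaloisGroup ℚ} (hκ : κ.IsCyclotomic)
    (hγ : κ.IsTopGenerator γ) (hγ' : IsCyclotomicVariable 2 γ) (hf : IsNewformOf W f)
    (D : W.SelmerDualData κ γ) {ϖ : ℚ} (hϖ : (ϖ : ℝ) * W.realPeriodRat = plusPeriod f)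
    {L₀ : IwasawaAlgebra 2}
    (hL₀ : iwasawaToPowerSeries 2 L₀ =
      PowerSeries.C (ϖ : ℚ_[2]) * padicLFunction f (unitRoot W 2 : ℚ_[2])) (hμ0 : mu L₀ = 0) :
    D.charIdeal = Ideal.span {L₀} ↔ lam L₀ ≤ D.lambda ∧ MissingUpperBoundAt W 2 := by
  rw [charIdeal_eq_span_iff_lam_le_and_mu_le_and_missingUpperBoundAt W h17 hEC hGZK hord hL hκ hγ hγ' hf D hϖ
    hL₀, hμ0]
  exact ⟨fun h => ⟨h.1.1, h.2⟩, fun h => ⟨⟨h.1, Nat.zero_le _⟩, h.2⟩⟩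

/-- **The λ-FORM of the `μ = 0` residue at a datum.** Same data, `μ(L₀) = 0`, and BOTH descent inequalities
`ord₂ #Ш_an ≤ ord₂ #Ш` (`hlow`) and `ord₂ #Ш ≤ ord₂ #Ш_an` (`hup`) (e.g. `BSD(E,2)`): then `μ(X) = 0 ⟺ λ(L₀) ≤ λ(X)`.
(Both sides are the main conjecture at the datum: by the tree's (C) with `hlow`, resp. by §1 with `hup`.)
[cite: Kato2004Asterisque, Thm. 17.4 (1)(2) (p. 273)] [cite: GreenbergLNM1716, Thm. 4.1 (p. 102)] -/
theorem mu_eq_zero_iff_lam_le {N : ℕ} [NeZero N]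
    {f : CuspForm (Gamma0 N) 2} (h17 : kato_divisibility_allPrimes W 2 (f := f))
    (hEC : O1.TwoAdicEulerCharRankZero W 0) (hGZK : rank_eq_analyticRank_of_analyticRank_le_one)
    (hord : IsOrdinaryAt W 2) (hL : W.entireLFunction 1 ≠ 0)
    {κ : ZpExtension ℚ 2} {γ : Field.absoluteGaloisGroup ℚ} (hκ : κ.IsCyclotomic)
    (hγ : κ.IsTopGenerator γ) (hγ' : IsCyclotomicVariable 2 γ) (hf : IsNewformOf W f)
    (D : W.SelmerDualData κ γ) {ϖ : ℚ} (hϖ : (ϖ : ℝ) * W.realPeriodRat = plusPeriod f)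
    {L₀ : IwasawaAlgebra 2}
    (hL₀ : iwasawaToPowerSeries 2 L₀ =
      PowerSeries.C (ϖ : ℚ_[2]) * padicLFunction f (unitRoot W 2 : ℚ_[2])) (hμ0 : mu L₀ = 0)
    (hlow : MissingLowerBoundAt W 2) (hup : MissingUpperBoundAt W 2) :
    D.mu = 0 ↔ lam L₀ ≤ D.lambda := by
  have hC := charIdeal_eq_span_iff_mu_le_and_missingLowerBoundAt W h17 hEC hGZK hord hL hκ hγ hγ' hf D hϖ hL₀
  have hE := charIdeal_eq_span_iff_lam_le_and_missingUpperBoundAt_of_mu_eq_zero W h17 hEC hGZK hord hL hκ hγ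
    hγ' hf D hϖ hL₀ hμ0
  rw [hμ0] at hC
  constructor
  · intro hμ
    exact ((hE.mp (hC.mpr ⟨hμ.le, hlow⟩))).1
  · intro hlam
    exact Nat.le_zero.mp (hC.mp (hE.mpr ⟨hlam, hup⟩)).1

/-- **Equality form.** Same data: `μ(X) = 0 ⟺ λ(X) = λ(L₀)` (Kato's (2) gives `λ(X) ≤ λ(L₀)` unconditionally, reading
(iii) of `sha_readings_of_kato`). [cite: Kato2004Asterisque, Thm. 17.4 (1)(2) (p. 273)]
[cite: GreenbergLNM1716, Thm. 4.1 (p. 102)] -/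
theorem mu_eq_zero_iff_lambda_eq_lam {N : ℕ} [NeZero N]
    {f : CuspForm (Gamma0 N) 2} (h17 : kato_divisibility_allPrimes W 2 (f := f))
    (hEC : O1.TwoAdicEulerCharRankZero W 0) (hGZK : rank_eq_analyticRank_of_analyticRank_le_one)
    (hord : IsOrdinaryAt W 2) (hL : W.entireLFunction 1 ≠ 0)
    {κ : ZpExtension ℚ 2} {γ : Field.absoluteGaloisGroup ℚ} (hκ : κ.IsCyclotomic)
    (hγ : κ.IsTopGenerator γ) (hγ' : IsCyclotomicVariable 2 γ) (hf : IsNewformOf W f)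
    (D : W.SelmerDualData κ γ) {ϖ : ℚ} (hϖ : (ϖ : ℝ) * W.realPeriodRat = plusPeriod f)
    {L₀ : IwasawaAlgebra 2}
    (hL₀ : iwasawaToPowerSeries 2 L₀ =
      PowerSeries.C (ϖ : ℚ_[2]) * padicLFunction f (unitRoot W 2 : ℚ_[2])) (hμ0 : mu L₀ = 0)
    (hlow : MissingLowerBoundAt W 2) (hup : MissingUpperBoundAt W 2) :
    D.mu = 0 ↔ D.lambda = lam L₀ := by
  have hϖ0 : ϖ ≠ 0 := X2.varpi_ne_zero_of_isNewformOf hf hϖ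
  obtain ⟨fX, hfX⟩ := (charIdeal_isPrincipal_holds 2 D.X).principal
  obtain ⟨-, -, -, -, h3⟩ :=
    sha_readings_of_kato W h17 hEC hGZK hord hL hκ hγ hγ' hf D hϖ hϖ0 hfX hL₀
  rw [mu_eq_zero_iff_lam_le W h17 hEC hGZK hord hL hκ hγ hγ' hf D hϖ hL₀ hμ0 hlow hup]
  exact ⟨fun h => le_antisymm h3 h, fun h => h.ge⟩

end Datum

/-! ## §2 Curve level: the main conjecture from the EISENSTEIN half + the UPPER bound on `Ш` (rank `0`) -/

section Curve

variable (W : WeierstrassCurve ℚ) [W.IsElliptic] [W.IsGloballyMinimal]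

/-- **The `2`-adic main conjecture on a rank-`0` good-ordinary-at-`2` curve from the EISENSTEIN HALF and the UPPER bound
on `Ш`.** PUBLISHED inputs as hypotheses: Kato 17.4 (1)(2) AT `2` (`h17`), Greenberg 4.1 AT `2` (`hEC`), GZK (`hGZK`),
modularity (`hmod`); the Néron-integrality certificate `hper₀` (`0 ≤ ord₂ ϖ`); the Eisenstein half
`X5.O1.MainConjectureEisensteinDivisibilityAtTwo W` (crux `OrdEisensteinHalfAtTwo` of route ByReductionTypeAtTwo at `W`) and
`MissingUpperBoundAt W 2` (`ord₂ #Ш ≤ ord₂ #Ш_an`). MIRROR of the tree's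
`EisensteinShaCurrency.mazurMainConjecture_two_of_katoHalf_of_missingLowerBoundAt` (Kato half + LOWER bound): the Eisenstein
half at a datum gives `λ(L₀) ≤ λ(X)` ∧ `μ(L₀) ≤ μ(X)` (tree `eisensteinAtDatum_iff_lam_le_and_mu_le`) and §1 concludes.
[cite: Kato2004Asterisque, Thm. 17.4 (1)(2) (p. 273)] [cite: GreenbergLNM1716, Thm. 4.1 (p. 102)]
[cite: SkinnerUrban2014, Conj. 3.6.8 (p. 45) (shape of the Eisenstein inclusion; p odd in print)] -/
theorem mazurMainConjecture_two_of_eisensteinHalf_of_missingUpperBoundAt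
    (h17 : ∀ [NeZero (W.conductorNorm ℤ)] (f : CuspForm (Gamma0 (W.conductorNorm ℤ)) 2),
      kato_divisibility_allPrimes W 2 (f := f))
    (hper₀ : ∀ [NeZero (W.conductorNorm ℤ)] (f : CuspForm (Gamma0 (W.conductorNorm ℤ)) 2),
      IsNewformOf W f → ∀ ϖ : ℚ, (ϖ : ℝ) * W.realPeriodRat = plusPeriod f → 0 ≤ padicValRat 2 ϖ)
    (hEC : O1.TwoAdicEulerCharRankZero W 0) (hGZK : rank_eq_analyticRank_of_analyticRank_le_one)
    (hmod : nonempty_modularParametrizationData) (hgo : GoodOrd W 2) (hr : W.analyticRank = 0)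
    (hE : O1.MainConjectureEisensteinDivisibilityAtTwo W) (hup : MissingUpperBoundAt W 2) :
    MazurMainConjecture W 2 := by
  intro κ γ hκ hγ hγ' _ f hf ϖ hϖ D
  have hord : IsOrdinaryAt W 2 := hgo
  haveI : Module.Finite (IwasawaAlgebra 2) D.X := D.module_finite_holds hγ
  have hL : W.entireLFunction 1 ≠ 0 := entireLFunction_one_ne_zero_of_analyticRank_eq_zero hmod W hr
  have hD : D.IsTorsion := (h17 f κ γ hκ hγ hγ' hord hf D).1
  obtain ⟨L₀, hL₀⟩ :=
    O1.exists_integral_mul_padicLFunction_two_of_padicValRat_nonneg W hord hf (hper₀ f hf ϖ hϖ)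
  have hL₀0 : L₀ ≠ 0 := ne_zero_of_iwasawaToPowerSeries_eq W hord hf
    (X2.varpi_ne_zero_of_isNewformOf hf hϖ) hL₀
  obtain ⟨fX, hfX⟩ := (charIdeal_isPrincipal_holds 2 D.X).principal
  have hchar : D.charIdeal = Ideal.span {fX} := hfX
  have hlm : lam L₀ ≤ D.lambda ∧ mu L₀ ≤ D.mu :=
    (EisensteinLowerBounds.eisensteinAtDatum_iff_lam_le_and_mu_le W (h17 f) hκ hγ hγ' hord hf D hchar hL₀0
      hL₀).mp (hE κ γ hκ hγ hγ' hord f hf ϖ hϖ D fX hchar)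
  exact ⟨hD, L₀, (charIdeal_eq_span_iff_lam_le_and_mu_le_and_missingUpperBoundAt W (h17 f) hEC hGZK hord hL
    hκ hγ hγ' hf D hϖ hL₀).mpr ⟨hlm, hup⟩, hL₀⟩

/-- **The `2`-adic main conjecture on a rank-`0` good-ordinary curve gives the UPPER bound on `Ш`** (PUB as hypotheses;
no Eisenstein/Kato half, no `hper₀`): at the conductor-level newform (`hmod`), the Néron ratio of the modular
parametrization datum and any cyclotomic datum (both exist: tree theorems
`exists_rat_mul_realPeriodRat_eq_plusPeriod`, `exists_isCyclotomic_isTopGenerator_isCyclotomicVariable_holds`,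
`nonempty_selmerDualData_holds`), §1 (⇒) reads `ord₂ #Ш ≤ ord₂ #Ш_an` off `char_Λ X = (g)`.
[cite: Kato2004Asterisque, Thm. 17.4 (1)(2) (p. 273)] [cite: GreenbergLNM1716, Thm. 4.1 (p. 102)] -/
theorem missingUpperBoundAt_two_of_mazurMainConjecture
    (h17 : ∀ [NeZero (W.conductorNorm ℤ)] (f : CuspForm (Gamma0 (W.conductorNorm ℤ)) 2),
      kato_divisibility_allPrimes W 2 (f := f))
    (hEC : O1.TwoAdicEulerCharRankZero W 0) (hGZK : rank_eq_analyticRank_of_analyticRank_le_one)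
    (hmod : nonempty_modularParametrizationData) (hgo : GoodOrd W 2) (hr : W.analyticRank = 0)
    (hMC : MazurMainConjecture W 2) : MissingUpperBoundAt W 2 := by
  have hord : IsOrdinaryAt W 2 := hgo
  have hL : W.entireLFunction 1 ≠ 0 := entireLFunction_one_ne_zero_of_analyticRank_eq_zero hmod W hr
  haveI : NeZero (W.conductorNorm ℤ) := ⟨(W.conductorNorm_pos_holds).ne'⟩
  obtain ⟨Dm⟩ := hmod W
  have hf : IsNewformOf W Dm.f := Dm.isNewformOf
  obtain ⟨ϖ, -, hϖ, -⟩ := Dm.exists_rat_mul_realPeriodRat_eq_plusPeriod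
  obtain ⟨κ, hκ, γ, hγ, hγ'⟩ := exists_isCyclotomic_isTopGenerator_isCyclotomicVariable_holds 2
  obtain ⟨D⟩ := W.nonempty_selmerDualData_holds κ γ hγ
  obtain ⟨-, g, hchar, hιg⟩ := hMC κ γ hκ hγ hγ' Dm.f hf ϖ hϖ D
  exact ((charIdeal_eq_span_iff_lam_le_and_mu_le_and_missingUpperBoundAt W (h17 Dm.f) hEC hGZK hord hL hκ hγ
    hγ' hf D hϖ hιg).mp hchar).2

/-- **Granted the Eisenstein half at a rank-`0` good-ordinary curve, the `2`-adic main conjecture IS the upper bound on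
`Ш`** — mirror of the tree's `mazurMainConjecture_two_iff_missingLowerBoundAt_of_katoHalf`.
[cite: Kato2004Asterisque, Thm. 17.4 (1)(2) (p. 273)] [cite: GreenbergLNM1716, Thm. 4.1 (p. 102)] -/
theorem mazurMainConjecture_two_iff_missingUpperBoundAt_of_eisensteinHalf
    (h17 : ∀ [NeZero (W.conductorNorm ℤ)] (f : CuspForm (Gamma0 (W.conductorNorm ℤ)) 2),
      kato_divisibility_allPrimes W 2 (f := f))
    (hper₀ : ∀ [NeZero (W.conductorNorm ℤ)] (f : CuspForm (Gamma0 (W.conductorNorm ℤ)) 2),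
      IsNewformOf W f → ∀ ϖ : ℚ, (ϖ : ℝ) * W.realPeriodRat = plusPeriod f → 0 ≤ padicValRat 2 ϖ)
    (hEC : O1.TwoAdicEulerCharRankZero W 0) (hGZK : rank_eq_analyticRank_of_analyticRank_le_one)
    (hmod : nonempty_modularParametrizationData) (hgo : GoodOrd W 2) (hr : W.analyticRank = 0)
    (hE : O1.MainConjectureEisensteinDivisibilityAtTwo W) :
    MazurMainConjecture W 2 ↔ MissingUpperBoundAt W 2 :=
  ⟨missingUpperBoundAt_two_of_mazurMainConjecture W h17 hEC hGZK hmod hgo hr,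
    mazurMainConjecture_two_of_eisensteinHalf_of_missingUpperBoundAt W h17 hper₀ hEC hGZK hmod hgo hr hE⟩

end Curve

end Summit.BirchSwinnertonDyer.BirchSwinnertonDyer.Theorems.AlignedTransportAtTwoSeedLambda

end
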